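import Summits.Schanuel.Schanuel.Theorems.RootDecomp1KHyper50

/-!
# RootDecomp1KHyper — lens 6, generation 16/17 «ALGEBRAIC-LATTICE-ANCHORED CELL» (AlgLatAnchor.lean edition 2 42f80a0c…, 1588 l) — continuation (RootDecomp1KHyper51): §G the Gaussian member `zG = (1, i, y_C(i))` (`placement_zG (hLW)`) ; §H `not_hasMeasuredRatAnchor_zG` (hypothesis-free)

(lens-6 g16/g17 `AlgLatAnchor.lean` edition 2, sha256 42f80a0c…8416, own farm rc 0 · 0 sorry · axioms std; critic VERDICT STATUS L1677 / L1713 PORT GO LOW;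
port by census-1 gen 15 in six parts `RootDecomp1KHyper47`–`52` — see the PORT NOTE of part 47; `--supports stmt-Schanuel-33363`; rung 0.)
-/

open Complex IntermediateField Polynomial

namespace Summit.Schanuel.Schanuel.Theorems.RootDecomp1KHyper

namespace HyperCell

namespace LatCell

variable {n : ℕ}
open Summit.Schanuel.Schanuel.Theorems.RootDecomp1KGeneric (HasHLPairInSpan Rank3SpanResidual
  mem_adjoin_of_mem_span cexp_mem_adjoin_of_mem_span)

/-! ## §G  Certified members: the Gaussian triple `z_G = (1, i, y_C(i))` and the cyclotomic
triple `z_8 = (1, ζ₈, y_C(ζ₈))`, each INSIDE the residual of record and decided by the new cell -/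

/-- `i` is an algebraic integer (root of `T² + 1`). -/
private theorem isIntegral_I : IsIntegral ℤ (I : ℂ) := by
  refine ⟨Polynomial.X ^ 2 + Polynomial.C 1, Polynomial.monic_X_pow_add_C 1 two_ne_zero, ?_⟩
  simp [Polynomial.eval₂_add, Polynomial.eval₂_X_pow, Complex.I_sq]

/-- `i` is algebraic over ℚ. -/
private theorem isAlgebraic_I' : IsAlgebraic ℚ (I : ℂ) :=
  (IsFractionRing.isAlgebraic_iff ℤ ℚ ℂ).mp isIntegral_I.isAlgebraic

/-- `(1, ξ)` is ℚ-free when `ξ ∉ ℝ`. -/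
private theorem linearIndependent_one_of_im_ne_zero {ξ : ℂ} (hξi : ξ.im ≠ 0) :
    LinearIndependent ℚ ![(1 : ℂ), ξ] := by
  refine LinearIndependent.pair_iff.mpr fun s t hst => ?_
  rw [Rat.smul_def, Rat.smul_def] at hst
  have him := congr_arg Complex.im hst
  simp only [Complex.add_im, Complex.mul_im, Complex.ratCast_re, Complex.ratCast_im,
    zero_mul, add_zero, mul_one, Complex.zero_im, zero_add] at him
  have ht : t = 0 := by
    have htR : (t : ℝ) = 0 := (mul_eq_zero.mp him).resolve_right hξi
    exact_mod_cast htR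
  subst ht
  have hre := congr_arg Complex.re hst
  simp at hre
  exact ⟨by exact_mod_cast hre, rfl⟩

/-- **`HasAlgLatAnchor (1, ξ, y_C(ξ))`** for algebraic `ξ ∉ ℝ` (anchor `(w₁, w₂) = (1, ξ)`). -/
theorem hasAlgLatAnchor_latTriple_yC {ξ : ℂ} (hξa : IsAlgebraic ℚ ξ) (hξi : ξ.im ≠ 0) :
    HasAlgLatAnchor (latTriple 1 ξ (yC ξ)) :=
  ⟨1, ξ, isAlgebraic_one, hξa, linearIndependent_one_of_im_ne_zero hξi,
    by simpa using Submodule.subset_span (R := ℤ) (s := Set.range (latTriple 1 ξ (yC ξ))) ⟨0, rfl⟩,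
    by simpa using Submodule.subset_span (R := ℤ) (s := Set.range (latTriple 1 ξ (yC ξ))) ⟨1, rfl⟩⟩

/-- **Real elements of `span_ℤ(1, ξ, y_C(ξ))` are integers** (`ξ ∉ ℝ`): the `ξ`-coordinate
`b + c·y_od` vanishes, so `c = 0 = b` by the ℤ-freeness of `(1, y_ev, y_od)`. -/
theorem exists_int_of_real_mem_span_latTriple_yC {ξ : ℂ} (hξi : ξ.im ≠ 0) {v : ℂ}
    (hv : v ∈ Submodule.span ℤ (Set.range (latTriple 1 ξ (yC ξ)))) (hreal : v.im = 0) :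
    ∃ a : ℤ, v = a := by
  obtain ⟨u, rfl⟩ := (Submodule.mem_span_range_iff_exists_fun ℤ).mp hv
  rw [span_coords ξ u] at hreal ⊢
  have hq : (u 1 : ℝ) + (u 2 : ℝ) * yod = 0 := by
    have h1 : ξ.im * ((u 1 : ℝ) + (u 2 : ℝ) * yod) = 0 := by
      simpa [Complex.add_im, Complex.mul_im] using hreal
    exact (mul_eq_zero.mp h1).resolve_left hξi
  obtain ⟨h1, -, h2⟩ := int_free_one_yev_yod (u 1) 0 (u 2) (by push_cast; linarith only [hq])
  refine ⟨u 0, ?_⟩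
  simp [h1, h2]

/-- **`¬HasRealQuadAnchor (1, ξ, y_C(ξ))`** (`ξ ∉ ℝ`): `q₂√D` real in the span ⇒ an integer ⇒ `√D ∈ ℚ`. -/
theorem not_hasRealQuadAnchor_latTriple_yC {ξ : ℂ} (hξi : ξ.im ≠ 0) :
    ¬ HasRealQuadAnchor (latTriple 1 ξ (yC ξ)) := by
  rintro ⟨D, q₁, q₂, hD, -, hq₂, -, hm₂⟩
  obtain ⟨a, ha⟩ := exists_int_of_real_mem_span_latTriple_yC hξi hm₂ (by simp [Complex.mul_im])
  have hre : (q₂ : ℝ) * Real.sqrt D = a := by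
    have h1 := congr_arg Complex.re ha
    simpa [Complex.mul_re] using h1
  refine hD ⟨(a : ℚ) / q₂, ?_⟩
  have hq₂R : (q₂ : ℝ) ≠ 0 := by exact_mod_cast hq₂
  push_cast
  rw [div_eq_iff hq₂R, mul_comm]
  exact hre.symm

/-- **`¬HasPiLatAnchor (1, ξ, y_C(ξ))`** (`ξ ∉ ℝ`), UNCONDITIONALLY: `π` real in the span ⇒ `π ∈ ℤ`. -/
theorem not_hasPiLatAnchor_latTriple_yC {ξ : ℂ} (hξi : ξ.im ≠ 0) :
    ¬ HasPiLatAnchor (latTriple 1 ξ (yC ξ)) := by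
  rintro ⟨hπ, -⟩
  obtain ⟨a, ha⟩ := exists_int_of_real_mem_span_latTriple_yC hξi hπ (Complex.ofReal_im _)
  have h1 : Real.pi = (a : ℝ) := by exact_mod_cast ha
  exact irrational_pi ⟨a, by push_cast; exact h1.symm⟩

/-- … hence also `¬HasPiIntAnchor`. -/
theorem not_hasPiIntAnchor_latTriple_yC {ξ : ℂ} (hξi : ξ.im ≠ 0) :
    ¬ HasPiIntAnchor (latTriple 1 ξ (yC ξ)) :=
  fun h => not_hasPiLatAnchor_latTriple_yC hξi h.hasPiLatAnchor

/-- A non-zero `α` gives the ℚ-free singleton family `(α)`. -/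
private theorem linearIndependent_single_of_ne_zero {α : ℂ} (hα0 : α ≠ 0) :
    LinearIndependent ℚ (fun _ : Fin 1 => α) :=
  linearIndependent_unique_iff.mpr hα0

/-- The LW-measured singleton `θ = (e^{α})`, `α ∈ ℚ̄ ∖ {0}` (mod the LW measure). -/
theorem mvWeakMeasure_cexp_single (hLW : LWMeasure) {α : ℂ} (hα : IsAlgebraic ℚ α) (hα0 : α ≠ 0) :
    MvWeakMeasure (fun _ : Fin 1 => cexp α) :=
  MvPolyMeasure.mvWeakMeasure
    (mvPolyMeasure_exp_of_LW hLW (y := fun _ : Fin 1 => α) (fun _ => hα)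
      (linearIndependent_single_of_ne_zero hα0))

/-! ### The Gaussian member -/

/-- **The Gaussian member** `z_G = (1, i, y_C(i))`: `span_ℤ(z_G) = ℤ[i] + ℤ·y_C(i)`. -/
noncomputable def zG : Fin 3 → ℂ := latTriple 1 I (yC I)

/-- Literal read-out of `z_G = (1, i, y_C(i))`. -/
theorem zG_def : zG = latTriple 1 I (yC I) := rfl

/-- `y_C(i)` is hyper-approximable from the lattice `ℤ + ℤi`. -/
theorem hyperLatApprox_yC_I : HyperLatApprox 1 I (yC I) := hyperLatApprox_yC (by simp) (by simp)

/-- `z_G` is ℚ-free. -/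
theorem linearIndependent_zG : LinearIndependent ℚ zG := linearIndependent_latTriple_yC (by simp)

/-- `z_G` is `HyperLinLiouville`. -/
theorem hyperLinLiouville_zG : HyperLinLiouville zG := hyperLinLiouville_latTriple hyperLatApprox_yC_I

/-- `z_G` is genuinely TERNARY: hyper-small forms with ALL THREE coefficients non-zero. -/
theorem ternarySmallForms_zG (m : ℕ) : ∃ h : Fin 3 → ℤ, (∀ i, h i ≠ 0) ∧
    ‖∑ i, (h i : ℂ) * zG i‖ < Real.exp (-((1 + ∑ i, |(h i : ℝ)|) ^ m)) :=
  ternarySmallForms_yC (by simp) (by simp) m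

/-- `z_G` carries NO hyper-Liouville pair in its span (it lies in `Rank3SpanResidual`'s domain). -/
theorem not_hasHLPairInSpan_zG : ¬ HasHLPairInSpan zG := not_hasHLPairInSpan_latTriple_yC (by simp)

/-- `z_G` carries an algebraic-lattice anchor `(1, i)` (relative degree 2, NOT real-quadratic). -/
theorem hasAlgLatAnchor_zG : HasAlgLatAnchor zG := hasAlgLatAnchor_latTriple_yC isAlgebraic_I' (by simp)

/-- `z_G` is outside the Q-cell. -/
theorem not_hasRealQuadAnchor_zG : ¬ HasRealQuadAnchor zG := not_hasRealQuadAnchor_latTriple_yC (by simp)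

/-- `z_G` is outside the π-cells (unconditionally). -/
theorem not_hasPiLatAnchor_zG : ¬ HasPiLatAnchor zG := not_hasPiLatAnchor_latTriple_yC (by simp)

/-- `z_G` has no Nesterenko integer anchor. -/
theorem not_hasPiIntAnchor_zG : ¬ HasPiIntAnchor zG := not_hasPiIntAnchor_latTriple_yC (by simp)

set_option maxHeartbeats 800000 in
/-- **Key non-membership (mod LW)**: no `N·e^{α}` (`α ∈ ℚ̄ ∖ {0}`, `N ∈ ℤ ∖ {0}`) lies in `span_ℤ(z_G)`.
If `u₀ + u₁ i + u₂ y_C(i) = N e^{α}` then `(u₂ y − (N e^{α} − u₀))² + u₁² = 0` is an integer relation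
`Σ_k G_k(e^{α}) y^k = 0` with `G₀ = (N X − u₀)² + u₁² ≠ 0` — killed by the RESULTANT ENGINE
(`θ = (e^{α})` LW-measured, `ω = i`, `y = y_C(i)`). -/
theorem int_mul_cexp_not_mem_span_zG (hLW : LWMeasure) {α : ℂ} (hα : IsAlgebraic ℚ α) (hα0 : α ≠ 0)
    {N : ℤ} (hN : N ≠ 0) : (N : ℂ) * cexp α ∉ Submodule.span ℤ (Set.range zG) := by
  intro hmem
  obtain ⟨u, hu⟩ := (Submodule.mem_span_range_iff_exists_fun ℤ).mp hmem
  have hu' : (u 0 : ℂ) + (u 1 : ℂ) * I + (u 2 : ℂ) * yC I = (N : ℂ) * cexp α := by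
    rw [← hu, Fin.sum_univ_three]
    simp [zG, zsmul_eq_mul, mul_comm]
  have hθ := mvWeakMeasure_cexp_single hLW hα hα0
  -- the relation polynomials
  set P : MvPolynomial (Fin 1) ℤ := MvPolynomial.C N * MvPolynomial.X 0 - MvPolynomial.C (u 0)
    with hP
  set G : Fin 3 → MvPolynomial (Fin 1) ℤ :=
    ![P ^ 2 + MvPolynomial.C (u 1 ^ 2), MvPolynomial.C (-2 * u 2) * P, MvPolynomial.C (u 2 ^ 2)]
    with hG
  have hG0 : G 0 ≠ 0 := by
    intro h0
    have h0' : P ^ 2 + MvPolynomial.C (u 1 ^ 2) = 0 := by simpa [hG] using h0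
    have hev : ∀ t : ℤ, (N * t - u 0) ^ 2 + u 1 ^ 2 = 0 := by
      intro t
      have := congr_arg (MvPolynomial.eval fun _ : Fin 1 => t) h0'
      simpa [hP] using this
    have e0 := hev 0
    have e1 := hev 1
    have hu0 : u 0 = 0 := by nlinarith [sq_nonneg (u 0), sq_nonneg (u 1)]
    have hu1 : u 1 = 0 := by nlinarith [sq_nonneg (u 0), sq_nonneg (u 1)]
    rw [hu0, hu1] at e1
    have : N = 0 := by nlinarith [sq_nonneg N]
    exact hN this
  refine no_int_relation_of_mvWeakMeasure_hyperAlgLat hθ isIntegral_I hyperLatApprox_yC_I G ⟨0, hG0⟩ ?_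
  rw [Fin.sum_univ_three]
  simp only [hG, hP, Matrix.cons_val_zero, Matrix.cons_val_one, Matrix.cons_val_two,
    Matrix.head_cons, Matrix.tail_cons, map_add, map_sub, map_mul, map_pow, map_neg,
    MvPolynomial.aeval_C, MvPolynomial.aeval_X]
  simp only [algebraMap_int_eq, eq_intCast, Int.cast_ofNat, Fin.val_zero, Fin.val_one, Fin.val_two,
    pow_zero, pow_one, mul_one]
  linear_combination ((u 2 : ℂ) * yC I - (N : ℂ) * cexp α + (u 0 : ℂ) - (u 1 : ℂ) * I) * hu' +
    ((u 1 : ℂ)) ^ 2 * Complex.I_sq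

/-- **`¬HasExpLatAnchor z_G` (mod LW)** — `z_G` is outside the E-cells. -/
theorem not_hasExpLatAnchor_zG (hLW : LWMeasure) : ¬ HasExpLatAnchor zG := by
  rintro (⟨α, N₁, N₂, hα, hirr, -, hN₂, -, hm₂⟩ | ⟨α, N₁, N₂, hα, hli, hN₁, -, hm₁, -⟩)
  · exact int_mul_cexp_not_mem_span_zG hLW hα (fun h => hirr 0 (by rw [h]; simp)) hN₂ hm₂
  · exact int_mul_cexp_not_mem_span_zG hLW (hα 0) (by simpa using hli.ne_zero 0) hN₁
      (by simpa using hm₁)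

/-- **`z_G` is decided by the new cell (mod LW)**: `trdeg ℚ(z_G, e^{z_G}) ≥ 3`. -/
theorem sb_three_zG (hLW : LWMeasure) : SB 3 zG :=
  sb_three_of_algLatAnchor hLW linearIndependent_zG hyperLinLiouville_zG hasAlgLatAnchor_zG

/-- **PLACEMENT of `z_G`**: inside the domain of the residual of record `UnanchoredResidual₃‴`
(ℚ-free, `HyperLinLiouville`, no HL pair, no real-quadratic / exp-lattice / π-lattice anchor) and
decided by the algebraic-lattice cell. -/
theorem placement_zG (hLW : LWMeasure) :
    LinearIndependent ℚ zG ∧ HyperLinLiouville zG ∧ ¬ HasHLPairInSpan zG ∧ ¬ HasRealQuadAnchor zG ∧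
      ¬ HasExpLatAnchor zG ∧ ¬ HasPiLatAnchor zG ∧ HasAlgLatAnchor zG ∧ SB 3 zG :=
  ⟨linearIndependent_zG, hyperLinLiouville_zG, not_hasHLPairInSpan_zG, not_hasRealQuadAnchor_zG,
    not_hasExpLatAnchor_zG hLW, not_hasPiLatAnchor_zG, hasAlgLatAnchor_zG, sb_three_zG hLW⟩

/-! ## §H  `z_G` is OUTSIDE `HasMeasuredRatAnchors` (relative degree 1), UNCONDITIONALLY

`HasMeasuredRatAnchor z` packages EXACTLY the data of the tree theorem
`RootDecomp1KHyper41.sb_three_of_measuredRatAnchor` (a weakly measured pair `θ ⊂ ℚ(z, e^z, i)` and two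
`ℚ(θ)`-rational, polynomially independent anchors in the span).  For `z_G` any such anchor is
DEGENERATE (`W = a·q`, by the resultant engine with `ω = i`), contradicting independence. -/

/-- **`HasMeasuredRatAnchor z`** — the hypotheses of `sb_three_of_measuredRatAnchor` as a predicate:
a weakly measured `θ ⊂ ℚ(z, e^z, i)` and anchors `v_i = W_i(θ)/q(θ) ∈ span_ℤ(z)`, `(W₁, W₂)` independent. -/
def HasMeasuredRatAnchor (z : Fin 3 → ℂ) : Prop :=
  ∃ (θ : Fin 2 → ℂ) (W₁ W₂ q : MvPolynomial (Fin 2) ℤ) (v₁ v₂ : ℂ), MvWeakMeasure θ ∧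
    (∀ i, θ i ∈ adjoin ℚ (SFset z ∪ {I})) ∧ MvPolynomial.aeval θ q ≠ 0 ∧
    (∀ U V : ℤ, (U ≠ 0 ∨ V ≠ 0) → MvPolynomial.C U * W₁ + MvPolynomial.C V * W₂ ≠ 0) ∧
    MvPolynomial.aeval θ q * v₁ = MvPolynomial.aeval θ W₁ ∧
    MvPolynomial.aeval θ q * v₂ = MvPolynomial.aeval θ W₂ ∧
    v₁ ∈ Submodule.span ℤ (Set.range z) ∧ v₂ ∈ Submodule.span ℤ (Set.range z)

/-- The predicate is faithful: it is exactly what the tree's relative-degree-1 cell theorem consumes. -/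
theorem sb_three_of_hasMeasuredRatAnchor {z : Fin 3 → ℂ} (hz : LinearIndependent ℚ z)
    (hH : HyperLinLiouville z) (h : HasMeasuredRatAnchor z) : SB 3 z := by
  obtain ⟨θ, W₁, W₂, q, v₁, v₂, hθ, hθz, hq, hW, hv₁, hv₂, h₁, h₂⟩ := h
  exact sb_three_of_measuredRatAnchor hz hH hθ hθz W₁ W₂ q hq hW hv₁ hv₂ h₁ h₂

set_option maxHeartbeats 800000 in
/-- **Degeneracy of `ℚ(θ)`-rational anchors in `span_ℤ(z_G)`** (NO hypothesis on `θ` beyond the weak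
measure): `q(θ)·v = W(θ)` with `v = u₀ + u₁ i + u₂ y_C(i) ∈ span_ℤ(z_G)` forces `W = u₀·q`
(the relation `(u₂ q(θ) y − (W(θ) − u₀ q(θ)))² + u₁² q(θ)² = 0` is killed by the resultant engine
unless all its coefficient polynomials vanish, which gives `u₂ = u₁ = 0`, `W = u₀ q`). -/
theorem ratAnchor_degenerate_zG {θ : Fin 2 → ℂ} (hθ : MvWeakMeasure θ)
    (W q : MvPolynomial (Fin 2) ℤ) (hq : MvPolynomial.aeval θ q ≠ 0) {v : ℂ}
    (hv : MvPolynomial.aeval θ q * v = MvPolynomial.aeval θ W)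
    (hmem : v ∈ Submodule.span ℤ (Set.range zG)) : ∃ a : ℤ, W = MvPolynomial.C a * q := by
  obtain ⟨u, hu⟩ := (Submodule.mem_span_range_iff_exists_fun ℤ).mp hmem
  have hu' : (u 0 : ℂ) + (u 1 : ℂ) * I + (u 2 : ℂ) * yC I = v := by
    rw [← hu, Fin.sum_univ_three]
    simp [zG, zsmul_eq_mul, mul_comm]
  have hq0 : q ≠ 0 := by
    rintro rfl
    exact hq (by simp)
  set Pu : MvPolynomial (Fin 2) ℤ := W - MvPolynomial.C (u 0) * q with hPu
  set G : Fin 3 → MvPolynomial (Fin 2) ℤ :=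
    ![Pu ^ 2 + MvPolynomial.C (u 1 ^ 2) * q ^ 2, MvPolynomial.C (-2 * u 2) * q * Pu,
      MvPolynomial.C (u 2 ^ 2) * q ^ 2] with hG
  -- every coefficient polynomial vanishes, else the engine refutes the relation
  have hall : ∀ k, G k = 0 := by
    by_contra hne
    push Not at hne
    refine no_int_relation_of_mvWeakMeasure_hyperAlgLat hθ isIntegral_I hyperLatApprox_yC_I G hne ?_
    rw [Fin.sum_univ_three]
    simp only [hG, hPu, Matrix.cons_val_zero, Matrix.cons_val_one, Matrix.cons_val_two,
      Matrix.head_cons, Matrix.tail_cons, map_add, map_sub, map_mul, map_pow, map_neg,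
      MvPolynomial.aeval_C]
    simp only [algebraMap_int_eq, eq_intCast, Int.cast_ofNat, Fin.val_zero, Fin.val_one, Fin.val_two,
      pow_zero, pow_one, mul_one]
    linear_combination
      (MvPolynomial.aeval θ q * (u 0 : ℂ) - MvPolynomial.aeval θ q * (u 1 : ℂ) * I +
          MvPolynomial.aeval θ q * (u 2 : ℂ) * yC I - MvPolynomial.aeval θ W) *
          MvPolynomial.aeval θ q * hu' +
        (MvPolynomial.aeval θ q * (u 0 : ℂ) - MvPolynomial.aeval θ q * (u 1 : ℂ) * I +
          MvPolynomial.aeval θ q * (u 2 : ℂ) * yC I - MvPolynomial.aeval θ W) * hv +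
        (u 1 : ℂ) ^ 2 * (MvPolynomial.aeval θ q) ^ 2 * Complex.I_sq
  have hG2 : MvPolynomial.C (u 2 ^ 2) * q ^ 2 = 0 := by simpa [hG] using hall 2
  have hG0 : Pu ^ 2 + MvPolynomial.C (u 1 ^ 2) * q ^ 2 = 0 := by simpa [hG] using hall 0
  have hu1 : u 1 = 0 := by
    by_contra h1
    apply hq0
    apply MvPolynomial.funext
    intro t
    have := congr_arg (MvPolynomial.eval t) hG0
    simp only [map_add, map_mul, map_pow, MvPolynomial.eval_C, map_zero] at this
    have h1' : (0 : ℤ) < u 1 ^ 2 := by positivity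
    rw [map_zero]
    nlinarith [sq_nonneg (MvPolynomial.eval t Pu), sq_nonneg (MvPolynomial.eval t q),
      mul_pos h1' (show (0:ℤ) < 1 by norm_num)]
  rw [hu1] at hG0
  have hPu0 : Pu = 0 := by
    have : Pu ^ 2 = 0 := by simpa using hG0
    exact pow_eq_zero_iff (two_ne_zero) |>.mp this
  refine ⟨u 0, ?_⟩
  have := hPu0
  rw [hPu, sub_eq_zero] at this
  exact this

/-- **`z_G ∉ HasMeasuredRatAnchors`, UNCONDITIONALLY**: no weakly-measured pair `θ` and no
`ℚ(θ)`-rational independent anchors exist in `span_ℤ(z_G)` — the member is anchored ONLY in relative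
degree `≥ 2` (here exactly 2: `ω = i`). -/
theorem not_hasMeasuredRatAnchor_zG : ¬ HasMeasuredRatAnchor zG := by
  rintro ⟨θ, W₁, W₂, q, v₁, v₂, hθ, -, hq, hW, hv₁, hv₂, h₁, h₂⟩
  obtain ⟨a₁, ha₁⟩ := ratAnchor_degenerate_zG hθ W₁ q hq hv₁ h₁
  obtain ⟨a₂, ha₂⟩ := ratAnchor_degenerate_zG hθ W₂ q hq hv₂ h₂
  by_cases h0 : a₁ = 0 ∧ a₂ = 0
  · exact hW 1 0 (Or.inl one_ne_zero) (by rw [ha₁, h0.1]; simp)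
  · have hUV : a₂ ≠ 0 ∨ -a₁ ≠ 0 := by
      by_cases ha : a₁ = 0
      · exact Or.inl (fun hb => h0 ⟨ha, hb⟩)
      · exact Or.inr (neg_ne_zero.mpr ha)
    exact hW a₂ (-a₁) hUV (by rw [ha₁, ha₂, map_neg]; ring)

end LatCell

end HyperCell

end Summit.Schanuel.Schanuel.Theorems.RootDecomp1KHyper
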